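import Summits.QuantumFields.YangMills.Theorems.BalabanUVNodesPortU8GlobalIdent

/-!
# PORT PT-B (U8), g3 file 12 — THE SANDWICH FOR 27931 v11-G₄'s GLOBAL TWO-VOLUME ROW (R4ᴰ), PART A: radii and labels (`R0 = ρ∕2 − 1`, `R3 = ρ∕4 − 2Mc`, `ρ = recordRNat`; `NoWrapAt R0 (−z)`
# for the N-slot labels `2|z| < ρ`), near∕far geometry of a bond relative to the label, the clause-transfer lemma (clauses of `A′ ∘ lift − B` at `β` ≤ clauses of `A′` at `lift β` +
# clauses of `B` at `β` when the stencil lifts bond by bond), and ★★ the PER-BOND FOUR CLAUSES for `E := Hr_{n+1}(y′) ∘ lift − Hr_n(y)` on the bonds of an off-wrap `X`: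
# NEAR bonds by Tok-182 ⊕ Tok-cmpU-cap ⊕ the window transport (✓file 9), FAR bonds by ‴ on both members ⊕ `tdist (lift ·) (lift ·) ≥ tdist`

Cell `ym-nodeO-ideate` ∕ `ym-balaban-port`, porter `ymgap-nodeO-port-PTB-1` (gen 3), item **stmt-QuantumFields-27931** `BalabanUVNodes.PortPieceLocalityU8` (text v11-G₄ `bca3cb0d9af367ce`).
`--supports stmt-QuantumFields-27931` (helper).  [I] = [Balaban1987RG1], [15] = [Balaban1985Variational], [B6] = [Balaban1984PropagatorsII].
HONEST FRAMING.  Bookkeeping + the sandwich estimate under the three DISPLAYED tokens of v11-G₄ (‴, Tok-182, Tok-cmpU-cap — asserted by nobody); nothing of Bałaban's analysis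
asserted∕ported∕discharged; 27931 OPEN · SIGNED v11-G₄ · close HOLD until the slot word; K0⁷ OPEN; NODE O 0∕1; COUNT 8∕28 · K 1∕4 UNMOVED; finite `𝕋⁴_{L^K}` at fixed ε — NOT continuum ∕ OS ∕
Clay; **the Yang–Mills mass gap (Clay) is NOT proved by any of this.**
-/

noncomputable section

open scoped BigOperators Matrix.Norms.L2Operator

namespace Summit.QuantumFields.YangMills.Theorems.PortU8

open Literature.MathematicalPhysics.QuantumFieldTheory.Balaban1983to89
open Literature.MathematicalPhysics.QuantumFieldTheory.Balaban1983to89.Node00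
open Literature.MathematicalPhysics.QuantumFieldTheory.Balaban1983to89.T4Continuum (T4Family)
open Literature.MathematicalPhysics.QuantumFieldTheory.Balaban1983to89.B14.Eq213MaximalDomains (side)
open Summit.QuantumFields.YangMills.Theorems.K0RecordFormatNames

variable (F : T4Family)

/-! ## §1  The record's radius `ρ = recordRNat`, the sandwich radii `R0 = ρ∕2 − 1`, `R3 = ρ∕4 − 2Mc`, and the N-slot labels -/

variable {F} in
/-- `q ≥ 2L` on the tiled range (`q · L^{k+1+c} = 2L^{m+K}`, `k + 1 + c ≤ K`, `m ≥ 1`). [cite: Balaban1987RG1, (0.1) p.251, (1.21) p.264 (bookkeeping)] -/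
theorem two_mul_L_le_domCount {Mc k K : ℕ} (hMc : McGuard F Mc) (hK : recordK₀ F Mc k ≤ K) : 2 * F.L ≤ Sect2.domCount (F.P K) Mc (k + 1) := by
  have h0 := domCount_mul_side hMc hK
  obtain ⟨c, rfl⟩ := hMc
  have hL1 : 1 < F.L := F.hL.2
  have hKc : k + 1 + c ≤ K := by unfold recordK₀ at hK; rwa [Nat.log_pow hL1] at hK
  rw [T4Family.sitesPerDir_eq] at h0
  have hside : side (F.P K).L (F.L ^ c) (k + 1) = F.L ^ (k + 1 + c) := by unfold side; simp [pow_add]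
  rw [hside] at h0
  set e := F.m + K - (k + 1 + c) - 1 with hedef
  have he : F.m + K = e + 1 + (k + 1 + c) := by have := F.hm; omega
  have hq : Sect2.domCount (F.P K) (F.L ^ c) (k + 1) = 2 * (F.L ^ e * F.L) := by
    have hpos : 0 < F.L ^ (k + 1 + c) := Nat.pow_pos (by omega)
    apply Nat.eq_of_mul_eq_mul_right hpos
    calc Sect2.domCount (F.P K) (F.L ^ c) (k + 1) * F.L ^ (k + 1 + c) = 2 * F.L ^ (F.m + K) := h0
      _ = 2 * F.L ^ (e + 1 + (k + 1 + c)) := by rw [he]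
      _ = 2 * (F.L ^ e * F.L) * F.L ^ (k + 1 + c) := by ring
  rw [hq]
  have : 1 ≤ F.L ^ e := Nat.one_le_pow _ _ (by omega)
  nlinarith

variable {F} in
/-- **`N_{k+1} = 2ρ`**: the record's comparison radius `recordRNat = Mc·⌊q∕2⌋` is half the coarse torus side on the tiled range (`q` even). [cite: Balaban1987RG1, (1.21) p.264 (bookkeeping)] -/
theorem sitesPerDir_eq_two_mul_recordRNat {Mc k K : ℕ} (hMc : McGuard F Mc) (hK : recordK₀ F Mc k ≤ K) : (F.P K).sitesPerDir (k + 1) = 2 * recordRNat F Mc k K := by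
  have h := recordN_eq_domCount_mul hMc hK
  unfold recordN at h
  obtain ⟨t, ht⟩ := even_domCount hMc hK
  unfold recordRNat
  rw [h, ht, show (t + t) / 2 = t by omega]; ring

variable {F} in
/-- `ρ ≥ 13·Mc` (indeed `ρ = Mc·L^{m+n}`, `L ≥ 13`). [cite: Balaban1987RG1, (1.21) p.264 (bookkeeping)] -/
theorem thirteen_mul_le_recordRNat {Mc k K : ℕ} (hMc : McGuard F Mc) (hK : recordK₀ F Mc k ≤ K) : 13 * Mc ≤ recordRNat F Mc k K := by
  have hq := two_mul_L_le_domCount hMc hK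
  have hL : 13 ≤ F.L := by obtain ⟨r, hr⟩ := F.hL.1; have := F.hL11; omega
  unfold recordRNat
  have : 13 ≤ Sect2.domCount (F.P K) Mc (k + 1) / 2 := by omega
  nlinarith

variable {F} in
/-- ★ **THE SANDWICH RADII**: with `ρ := recordRNat`, `R0 := ρ∕2 − 1`, `R3 := ρ∕4 − 2Mc`: `R3 + nestRadius Mc 1 ≤ R0`, the proper-cube cap `2(R0 + 1) < N_{k+1}` in the member AND in the next one,
and the real bounds `R0 − R3 ≥ ρ∕4 − 2`, `R3 ≥ ρ∕4 − 2Mc − 1`, `4R3 ≤ ρ`. [cite: Balaban1987RG1, (1.21) p.264, p.290 L17–20 (bookkeeping)] -/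
theorem sandwich_radii {Mc k K : ℕ} (hMc : McGuard F Mc) (hK : recordK₀ F Mc k ≤ K) :
    recordRNat F Mc k K / 4 - 2 * Mc + nestRadius Mc 1 ≤ recordRNat F Mc k K / 2 - 1 ∧
    2 * (recordRNat F Mc k K / 2 - 1 + 1) < (F.P K).sitesPerDir (k + 1) ∧
    2 * (recordRNat F Mc k K / 2 - 1 + 1) < (F.P (K + 1)).sitesPerDir (k + 1) ∧
    ((recordRNat F Mc k K : ℝ) / 4 - 2 ≤ ((recordRNat F Mc k K / 2 - 1 : ℕ) : ℝ) - ((recordRNat F Mc k K / 4 - 2 * Mc : ℕ) : ℝ)) ∧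
    ((recordRNat F Mc k K : ℝ) / 4 - 2 * Mc - 1 ≤ ((recordRNat F Mc k K / 4 - 2 * Mc : ℕ) : ℝ)) ∧
    4 * (recordRNat F Mc k K / 4 - 2 * Mc) ≤ recordRNat F Mc k K := by
  have h13 := thirteen_mul_le_recordRNat hMc hK
  have hN := sitesPerDir_eq_two_mul_recordRNat hMc hK
  have hN' := sitesPerDir_eq_two_mul_recordRNat hMc (show recordK₀ F Mc k ≤ K + 1 by omega)
  have hMc1 : 1 ≤ Mc := by obtain ⟨c, rfl⟩ := hMc; exact Nat.one_le_pow _ _ (by have := F.hL.2; omega)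
  have hρ' : recordRNat F Mc k K ≤ recordRNat F Mc k (K + 1) := by
    unfold recordRNat; rw [domCount_succ_vol hMc hK]
    exact Nat.mul_le_mul_left _ (Nat.div_le_div_right (Nat.le_mul_of_pos_left _ (by have := F.hL.2; omega)))
  set ρ := recordRNat F Mc k K with hρ
  have hnr : nestRadius Mc 1 = 2 * Mc := by have h16 : ((1 : Fin 6) : ℕ) = 1 := rfl; unfold nestRadius; omega
  refine ⟨by omega, by omega, by omega, ?_, ?_, by omega⟩
  · have h1 : ((ρ / 2 - 1 : ℕ) : ℝ) = ((ρ / 2 : ℕ) : ℝ) - 1 := by rw [Nat.cast_sub (by omega)]; simp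
    have h2 : ((ρ / 4 - 2 * Mc : ℕ) : ℝ) ≤ ((ρ / 4 : ℕ) : ℝ) := by exact_mod_cast Nat.sub_le _ _
    have h3n := Nat.lt_div_mul_add (a := ρ) (b := 2) two_pos
    have h3c : (ρ : ℝ) < ((ρ / 2 * 2 + 2 : ℕ) : ℝ) := by exact_mod_cast h3n
    push_cast at h3c
    have h4n := Nat.div_mul_le_self ρ 4
    have h4c : ((ρ / 4 * 4 : ℕ) : ℝ) ≤ ρ := by exact_mod_cast h4n
    push_cast at h4c
    linarith
  · have h3n := Nat.lt_div_mul_add (a := ρ) (b := 4) (by norm_num)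
    have h3c : (ρ : ℝ) < ((ρ / 4 * 4 + 4 : ℕ) : ℝ) := by exact_mod_cast h3n
    push_cast at h3c
    have h2 : ((ρ / 4 : ℕ) : ℝ) - 2 * Mc ≤ ((ρ / 4 - 2 * Mc : ℕ) : ℝ) := by
      by_cases h : 2 * Mc ≤ ρ / 4
      · rw [Nat.cast_sub h]; push_cast; exact le_rfl
      · rw [Nat.sub_eq_zero_of_le (by omega)]
        have hc : ((ρ / 4 : ℕ) : ℝ) < ((2 * Mc : ℕ) : ℝ) := by exact_mod_cast (by omega : ρ / 4 < 2 * Mc)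
        push_cast at hc ⊢
        linarith
    linarith

variable {F} in
/-- ★ **THE N-SLOT LABELS DO NOT WRAP**: for `2|z| < ρ`, `NoWrapAt F k K (ρ∕2 − 1) (−z)` (and then also in the next member). [cite: Balaban1987RG1, (1.21) p.264] -/
theorem noWrapAt_sandwich {Mc k K : ℕ} (hMc : McGuard F Mc) (hK : recordK₀ F Mc k ≤ K) {z : Fin 4 → ℤ} (hz : ∀ l, 2 * |z l| < (recordRNat F Mc k K : ℤ)) :
    NoWrapAt F k K (recordRNat F Mc k K / 2 - 1) (-z) := by
  intro μ
  have hN := sitesPerDir_eq_two_mul_recordRNat hMc hK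
  have h13 := thirteen_mul_le_recordRNat hMc hK
  have hMc1 : 1 ≤ Mc := by obtain ⟨c, rfl⟩ := hMc; exact Nat.one_le_pow _ _ (by have := F.hL.2; omega)
  have hzμ := hz μ
  rw [Pi.neg_apply, abs_neg, hN]
  have hR : ((recordRNat F Mc k K / 2 - 1 : ℕ) : ℤ) = ((recordRNat F Mc k K / 2 : ℕ) : ℤ) - 1 := by rw [Nat.cast_sub (by omega)]; simp
  rw [hR]
  have h2 : 2 * ((recordRNat F Mc k K / 2 : ℕ) : ℤ) ≤ recordRNat F Mc k K := by exact_mod_cast Nat.mul_div_le _ 2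
  push_cast
  omega

/-- The window label's site is the centre `Φ(−z)`; it lies in every window about `−z`. [cite: Balaban1987RG1, (1.20)–(1.21) p.264 (bookkeeping)] -/
theorem recordE_snd_mem_recordWindow (k K R : ℕ) (μ : Fin 4) (z : Fin 4 → ℤ) : (recordE F k K μ z).2 ∈ recordWindow F k K R (-z) := by
  show siteOfInt F K (k + 1) (-z) ∈ windowSites F k K R (siteOfInt F K (k + 1) (-z))
  simp [windowSites]

/-! ## §2  Near and far bonds relative to the label -/

/-- **A coarse site inside the cube of radius `R` about the label's centre is at `ℓ¹` torus distance `≤ 4R` from it.** [cite: Balaban1987RG1, p.274 L8–9 (bookkeeping)] -/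
theorem tdist_le_of_mem_window {k K R : ℕ} {z₀ : Fin 4 → ℤ} {c : Site (F.P K) (k + 1)} (hc : c ∈ recordWindow F k K R z₀) :
    Site.tdist c (siteOfInt F K (k + 1) z₀) ≤ 4 * R := by
  unfold recordWindow windowSites at hc
  simp only [Finset.mem_filter, Finset.mem_univ, true_and] at hc
  unfold Site.tdist
  calc ∑ μ : Fin (F.P K).d, min (c μ - siteOfInt F K (k + 1) z₀ μ).val (siteOfInt F K (k + 1) z₀ μ - c μ).val ≤ ∑ _μ : Fin (F.P K).d, R := Finset.sum_le_sum fun μ _ => hc μ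
    _ = 4 * R := by rw [Finset.sum_const, Finset.card_univ, smul_eq_mul, Fintype.card_fin]; rfl

/-- **A coarse site outside that cube is at torus distance `≥ R + 1`.** [cite: Balaban1987RG1, p.274 L8–9 (bookkeeping)] -/
theorem succ_le_tdist_of_not_mem_window {k K R : ℕ} {z₀ : Fin 4 → ℤ} {c : Site (F.P K) (k + 1)} (hc : c ∉ recordWindow F k K R z₀) :
    R + 1 ≤ Site.tdist c (siteOfInt F K (k + 1) z₀) := by
  unfold recordWindow windowSites at hc
  simp only [Finset.mem_filter, Finset.mem_univ, true_and, not_forall, not_le] at hc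
  obtain ⟨μ, hμ⟩ := hc
  unfold Site.tdist
  exact le_trans hμ (Finset.single_le_sum (f := fun ν => min (c ν - siteOfInt F K (k + 1) z₀ ν).val (siteOfInt F K (k + 1) z₀ ν - c ν).val) (fun _ _ => Nat.zero_le _) (Finset.mem_univ μ))

/-! ## §3  The clause-transfer lemma -/

section Transfer

variable {V : Type*} [NormedAddCommGroup V] [NormedSpace ℂ V]

/-- ★ **CLAUSE TRANSFER**: if the centred lift commutes with the stencil shifts at `x` (`hsh`, `hun`, `hus`), then for `E β″ := A′ (lift β″) − B β″` the four (190)-clause expressions at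
`β = (x, dir)` are bounded by the sum of those of `A′` at `lift β` and of `B` at `β`. [cite: Balaban1985Variational, (190) p.308 (bookkeeping)] -/
theorem clauses_sub_lift {K : ℕ} (A' : PBond (F.P (K + 1)) 0 → V) (B : PBond (F.P K) 0 → V) (x : Site (F.P K) 0) (dir : Fin (F.P K).d)
    (hsh : ∀ ν : Fin (F.P K).d, (liftSiteCtr F K 0 x).shift ν = liftSiteCtr F K 0 (x.shift ν))
    (hun : ∀ ν : Fin (F.P K).d, (liftSiteCtr F K 0 x).unshift ν = liftSiteCtr F K 0 (x.unshift ν))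
    (hus : ∀ ν μ' : Fin (F.P K).d, (liftSiteCtr F K 0 (x.unshift ν)).shift μ' = liftSiteCtr F K 0 ((x.unshift ν).shift μ'))
    {a₁ a₂ a₃ a₄ b₁ b₂ b₃ b₄ : ℝ}
    (hA1 : ‖A' ⟨liftSiteCtr F K 0 x, dir⟩‖ ≤ a₁)
    (hA2 : ∀ ν : Fin (F.P K).d, ‖A' ⟨(liftSiteCtr F K 0 x).shift ν, dir⟩ - A' ⟨liftSiteCtr F K 0 x, dir⟩‖ ≤ a₂)
    (hA3 : ‖∑ ν : Fin (F.P K).d, (A' ⟨(liftSiteCtr F K 0 x).shift ν, dir⟩ - (2 : ℂ) • A' ⟨liftSiteCtr F K 0 x, dir⟩ + A' ⟨(liftSiteCtr F K 0 x).unshift ν, dir⟩)‖ ≤ a₃)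
    (hA4 : ‖∑ ν : Fin (F.P K).d, ((A' ⟨liftSiteCtr F K 0 x, dir⟩ + A' ⟨(liftSiteCtr F K 0 x).shift dir, ν⟩ - A' ⟨(liftSiteCtr F K 0 x).shift ν, dir⟩ - A' ⟨liftSiteCtr F K 0 x, ν⟩) -
      (A' ⟨(liftSiteCtr F K 0 x).unshift ν, dir⟩ + A' ⟨((liftSiteCtr F K 0 x).unshift ν).shift dir, ν⟩ - A' ⟨((liftSiteCtr F K 0 x).unshift ν).shift ν, dir⟩ -
        A' ⟨(liftSiteCtr F K 0 x).unshift ν, ν⟩))‖ ≤ a₄)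
    (hB1 : ‖B ⟨x, dir⟩‖ ≤ b₁)
    (hB2 : ∀ ν : Fin (F.P K).d, ‖B ⟨x.shift ν, dir⟩ - B ⟨x, dir⟩‖ ≤ b₂)
    (hB3 : ‖∑ ν : Fin (F.P K).d, (B ⟨x.shift ν, dir⟩ - (2 : ℂ) • B ⟨x, dir⟩ + B ⟨x.unshift ν, dir⟩)‖ ≤ b₃)
    (hB4 : ‖∑ ν : Fin (F.P K).d, ((B ⟨x, dir⟩ + B ⟨x.shift dir, ν⟩ - B ⟨x.shift ν, dir⟩ - B ⟨x, ν⟩) -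
      (B ⟨x.unshift ν, dir⟩ + B ⟨(x.unshift ν).shift dir, ν⟩ - B ⟨(x.unshift ν).shift ν, dir⟩ - B ⟨x.unshift ν, ν⟩))‖ ≤ b₄) :
    letI E : PBond (F.P K) 0 → V := fun β => A' (liftBondCtr F K 0 β) - B β
    ‖E ⟨x, dir⟩‖ ≤ a₁ + b₁ ∧
    (∀ ν : Fin (F.P K).d, ‖E ⟨x.shift ν, dir⟩ - E ⟨x, dir⟩‖ ≤ a₂ + b₂) ∧
    ‖∑ ν : Fin (F.P K).d, (E ⟨x.shift ν, dir⟩ - (2 : ℂ) • E ⟨x, dir⟩ + E ⟨x.unshift ν, dir⟩)‖ ≤ a₃ + b₃ ∧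
    ‖∑ ν : Fin (F.P K).d, ((E ⟨x, dir⟩ + E ⟨x.shift dir, ν⟩ - E ⟨x.shift ν, dir⟩ - E ⟨x, ν⟩) -
      (E ⟨x.unshift ν, dir⟩ + E ⟨(x.unshift ν).shift dir, ν⟩ - E ⟨(x.unshift ν).shift ν, dir⟩ - E ⟨x.unshift ν, ν⟩))‖ ≤ a₄ + b₄ := by
  simp only [liftBondCtr, ← hsh, ← hun, ← hus]
  refine ⟨?_, fun ν => ?_, ?_, ?_⟩
  · exact (norm_sub_le _ _).trans (add_le_add hA1 hB1)
  · rw [show A' ⟨(liftSiteCtr F K 0 x).shift ν, dir⟩ - B ⟨x.shift ν, dir⟩ - (A' ⟨liftSiteCtr F K 0 x, dir⟩ - B ⟨x, dir⟩) =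
        (A' ⟨(liftSiteCtr F K 0 x).shift ν, dir⟩ - A' ⟨liftSiteCtr F K 0 x, dir⟩) - (B ⟨x.shift ν, dir⟩ - B ⟨x, dir⟩) by abel]
    exact (norm_sub_le _ _).trans (add_le_add (hA2 ν) (hB2 ν))
  · rw [show (∑ ν : Fin (F.P K).d, (A' ⟨(liftSiteCtr F K 0 x).shift ν, dir⟩ - B ⟨x.shift ν, dir⟩ - (2 : ℂ) • (A' ⟨liftSiteCtr F K 0 x, dir⟩ - B ⟨x, dir⟩) +
          (A' ⟨(liftSiteCtr F K 0 x).unshift ν, dir⟩ - B ⟨x.unshift ν, dir⟩))) =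
        (∑ ν : Fin (F.P K).d, (A' ⟨(liftSiteCtr F K 0 x).shift ν, dir⟩ - (2 : ℂ) • A' ⟨liftSiteCtr F K 0 x, dir⟩ + A' ⟨(liftSiteCtr F K 0 x).unshift ν, dir⟩)) -
          ∑ ν : Fin (F.P K).d, (B ⟨x.shift ν, dir⟩ - (2 : ℂ) • B ⟨x, dir⟩ + B ⟨x.unshift ν, dir⟩) by
      rw [← Finset.sum_sub_distrib]; refine Finset.sum_congr rfl fun ν _ => ?_; rw [smul_sub]; abel]
    exact (norm_sub_le _ _).trans (add_le_add hA3 hB3)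
  · rw [show (∑ ν : Fin (F.P K).d, ((A' ⟨liftSiteCtr F K 0 x, dir⟩ - B ⟨x, dir⟩ + (A' ⟨(liftSiteCtr F K 0 x).shift dir, ν⟩ - B ⟨x.shift dir, ν⟩) -
            (A' ⟨(liftSiteCtr F K 0 x).shift ν, dir⟩ - B ⟨x.shift ν, dir⟩) - (A' ⟨liftSiteCtr F K 0 x, ν⟩ - B ⟨x, ν⟩)) -
          ((A' ⟨(liftSiteCtr F K 0 x).unshift ν, dir⟩ - B ⟨x.unshift ν, dir⟩) + (A' ⟨((liftSiteCtr F K 0 x).unshift ν).shift dir, ν⟩ - B ⟨(x.unshift ν).shift dir, ν⟩) -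
            (A' ⟨((liftSiteCtr F K 0 x).unshift ν).shift ν, dir⟩ - B ⟨(x.unshift ν).shift ν, dir⟩) - (A' ⟨(liftSiteCtr F K 0 x).unshift ν, ν⟩ - B ⟨x.unshift ν, ν⟩)))) =
        (∑ ν : Fin (F.P K).d, ((A' ⟨liftSiteCtr F K 0 x, dir⟩ + A' ⟨(liftSiteCtr F K 0 x).shift dir, ν⟩ - A' ⟨(liftSiteCtr F K 0 x).shift ν, dir⟩ - A' ⟨liftSiteCtr F K 0 x, ν⟩) -
          (A' ⟨(liftSiteCtr F K 0 x).unshift ν, dir⟩ + A' ⟨((liftSiteCtr F K 0 x).unshift ν).shift dir, ν⟩ - A' ⟨((liftSiteCtr F K 0 x).unshift ν).shift ν, dir⟩ -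
            A' ⟨(liftSiteCtr F K 0 x).unshift ν, ν⟩))) -
          ∑ ν : Fin (F.P K).d, ((B ⟨x, dir⟩ + B ⟨x.shift dir, ν⟩ - B ⟨x.shift ν, dir⟩ - B ⟨x, ν⟩) -
            (B ⟨x.unshift ν, dir⟩ + B ⟨(x.unshift ν).shift dir, ν⟩ - B ⟨(x.unshift ν).shift ν, dir⟩ - B ⟨x.unshift ν, ν⟩)) by
      rw [← Finset.sum_sub_distrib]; refine Finset.sum_congr rfl fun ν _ => ?_; abel]
    exact (norm_sub_le _ _).trans (add_le_add hA4 hB4)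

end Transfer

end Summit.QuantumFields.YangMills.Theorems.PortU8

end
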